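import Summits.ResolutionOfSingularities.ResolutionOfSingularities.Theorems.HilbertSamuelEliminationSigmaMaxModificationsCorridor3WLadderIsoTailsEmbeddedStepStalk
import Literature.AlgebraicGeometry.Resolution.NearPointTauOrigin
import Literature.AlgebraicGeometry.Resolution.NearPointTauMonotone
import HarnessLib

/-!
# [OURS · L1 W4.2] D14 ROUTE H, object **H5 — THE FREE-RATIONAL STEP**, part 1/2: at a RATIONAL point of the `t`-chart the
# point is the ORIGIN of the chart of a shifted regular system of parameters, and `R′ = R[𝔪/t]_𝔔` is regular local of the
# same embedding dimension with r.s.p. `(t, (c_k − ã_k t)/t)` (crux chain w42, line `w_ladder` v7, row `stub_Wtop3M_pointed`,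
# kernel K1 `IsoFreeRationalTailsImpossible`; `--supports stmt-ResolutionOfSingularities-19249`, helper)

OURS (cell `res-hironaka`, slot ★L-G4 W4.2, hand res-type-071 for res-L1-w42-plan-1 RULINGS v3.14-4 (BH); spec =
res-L1-w42-lead-1's `D14-BRIDGE-CUT.md` sha16 `ca58498c1b3692f5`, ROUTE H row H5 «FREE-RATIONAL STEP DICTIONARY: with
`t := c_0` the exceptional equation at `x_{n+1}`: `IsRationalStep T pt n` ⇔ `κ(x_n) → κ(x_{n+1})` onto ⇔ `𝔴 = (t, e_k − a_k)_k`
with `a_k ∈ κ` LIFTABLE to `R`; `¬ IsSatelliteStep T pt n` ⇔ `x_{n+2}` lies in the `t`-chart of `Bl(R_{n+1})` ⇔ the new r.s.p. is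
`(t, y′)`, `y′_k = y_k/t − ã_k`»). NOT a statement of H. Hironaka's manuscript [Hironaka2017] (under review in the cell, unused
here) nor of [CossartJannsenSaito2020] / [CossartPiltant2008]; AI-written, weaker than expert review. Sorry-free PROOF file: no
definitions, no named facts. Continues `…IsoTailsEmbeddedStep` / `…IsoTailsEmbeddedStepStalk` (H4, same namespace).

## §4 Bridge to the Rees-chart model at a prime
* `isLocalization_chartRing_of_blowupAlgebra` — a localisation of the image-model chart `R[𝔪/c_j]` (`blowupAlgebra`) at `𝔔` is a
  localisation of the Rees-model chart `chartRing c j` at `ε⁻¹𝔔` (`ε` = the tree's `blowupAlgebra.toBlowupAlgebra`, Stacks 07Z3);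
* `origin_rsop` — at the ORIGIN of the chart (`𝔔 ∩ R = 𝔪`, all `c_k/c_j ∈ 𝔔`): `R[𝔪/c_j]_𝔔` is regular local of embedding
  dimension `d = μ(𝔪_R)` with regular system of parameters `(c_j/1, (c_k/c_j)/1)_{k ≠ j}` and `R → κ(R[𝔪/c_j]_𝔔)` onto — the
  tree's `isRegularLocalRing_and_span_originFamily` / `residue_comp_surjective_origin` ([CoP1] Lemma 4.3 (3), `NearPointTauOrigin`)
  transported along the bridge.

## §5 The free-rational step
* `exists_origin_presentation` — **MAIN.** In the setting of `exists_stalk_presentation` (H4), fix `j₀` (`t := c_{j₀}`) with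
  (FREE) `π♯σ(t) ∣ π♯σ(c_k)` for all `k` and (RAT) `κ(x) → κ(x′)` onto. Then for lifts `ã_k ∈ R` of the coordinates of `x′`
  and the SHIFTED r.s.p. `c̃ = shiftRsop c j₀ ã` (`c̃_{j₀} = t`, `c̃_k = c_k − ã_k t`; tree `NearPointTauMonotone`) the H4
  presentation holds AT THE INDEX `j₀` with `x′` the ORIGIN (`c̃_k/t ∈ 𝔔`), and `R′ = R[𝔪/t]_𝔔` is regular local with
  `μ(𝔪_{R′}) = d`, r.s.p. `(t/1, (c̃_k/t)/1)` and `R → κ(R′)` onto: the output has the input shape of H4, so the step ITERATES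
  with the same `t`. Proof: coordinates from (FREE)+(RAT); H4 for `c̃`; the chart index delivered is forced to be `j₀` by the
  unit argument of [CoP1] Lemma 4.3 (3) (`π♯σ(c̃_k) ∈ π♯σ(t)·𝔪_{x′}` for `k ≠ j₀`, `π♯σ(t)` a non-zero-divisor); origin by
  cancelling `π♯σ(t)`; r.s.p. by `origin_rsop`.
* `exists_index_forall_dvd` — (FREE) holds at SOME index (the first step of a tail: the chart of H4 itself).

Part 2/2 (`…IsoTailsFreeRationalDictionary`): the dictionary with `IsRationalStep` / `IsSatelliteStep` of Sketch C5 (p517256)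
and the tower form.

## References
* V. Cossart, O. Piltant, J. Algebra 320 (2008), proof of Lemma 4.3 (3), pp. 8–9. [CossartPiltant2008]
* U. Görtz, T. Wedhorn, *Algebraic Geometry I*, 2nd ed. (2020), (13.19), Prop. 13.91, Prop. 13.96 (2). [GortzWedhorn2020]
* The Stacks Project, Tags 0804, 07Z3, 0BIQ. [StacksProject]
-/

noncomputable section

-- the mandated cell namespace `Summit.ResolutionOfSingularities.ResolutionOfSingularities.…` re-enters the summit name
set_option linter.dupNamespace false

open CategoryTheory AlgebraicGeometry TopologicalSpace IsLocalRing
open Literature.AlgebraicGeometry.Resolution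

namespace Summit.ResolutionOfSingularities.ResolutionOfSingularities.Cruxes.SigmaMaxModifications.IdeasL1C5.EmbeddedStep

universe u

/-! ## §4. Bridge to the Rees-chart model at a prime: `R[𝔪/c_j]_𝔔` is the localisation of `chartRing c j` at `ε⁻¹𝔔` -/

section Bridge

variable {R : Type u} [CommRing R] {d : ℕ} (c : Fin d → R) (j : Fin d)

/-- **Bridge `blowupAlgebra ↝ chartRing` at a prime.** For a prime `𝔔` of the image-model chart `B = R[𝔪/c_j]` and a
localisation `L` of `B` at `𝔔`, `L` is the localisation of the Rees-model chart `chartRing c j = (R[𝔪t])_{(c_j t)}` at the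
prime `ε⁻¹𝔔` along the chart isomorphism `ε : chartRing c j ≅ B` (Stacks 07Z3; the tree's `blowupAlgebra.toBlowupAlgebra`,
a plain ring homomorphism, bijective), for the algebra structure `chartRing c j → B → L`. This lets the blowupAlgebra-model
presentations of this file use the Rees-model theorems of `NearPointTauOrigin.lean` (the origin of a chart).
[cite: StacksProject, Tag 07Z3] -/
theorem isLocalization_chartRing_of_blowupAlgebra
    (𝔔 : Ideal (blowupAlgebra (Ideal.span (Set.range c)) (c j))) [𝔔.IsPrime]
    (L : Type u) [CommRing L] [Algebra (blowupAlgebra (Ideal.span (Set.range c)) (c j)) L]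
    [IsLocalization.AtPrime L 𝔔] :
    @IsLocalization.AtPrime (chartRing c j) _ L _
      ((algebraMap (blowupAlgebra (Ideal.span (Set.range c)) (c j)) L).comp
        (blowupAlgebra.toBlowupAlgebra c j)).toAlgebra
      (𝔔.comap (blowupAlgebra.toBlowupAlgebra c j)) _ := by
  let ε : chartRing c j ≃+* blowupAlgebra (Ideal.span (Set.range c)) (c j) :=
    RingEquiv.ofBijective (blowupAlgebra.toBlowupAlgebra c j) (blowupAlgebra.toBlowupAlgebra_bijective c j)
  have hεe : ∀ y, ε y = blowupAlgebra.toBlowupAlgebra c j y := fun _ => rfl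
  have h := IsLocalization.isLocalization_of_base_ringEquiv (P := chartRing c j) 𝔔.primeCompl L ε.symm
  have hM : Submonoid.map ε.symm 𝔔.primeCompl = (𝔔.comap (blowupAlgebra.toBlowupAlgebra c j)).primeCompl := by
    ext y
    constructor
    · rintro ⟨b, hb, rfl⟩
      intro hy
      rw [SetLike.mem_coe, Ideal.mem_comap, ← hεe, RingEquiv.apply_symm_apply] at hy
      exact hb hy
    · intro hy
      refine ⟨ε y, fun h' => hy ?_, ε.symm_apply_apply y⟩
      rw [SetLike.mem_coe, Ideal.mem_comap, ← hεe]
      exact h'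
  rw [hM] at h
  convert h using 2
  exact RingHom.ext fun y => rfl

/-- **The ORIGIN of the chart `R[𝔪/c_j]`** (`R` regular local with r.s.p. `c`; `𝔔 ⊂ B = R[𝔪/c_j]` a prime over `𝔪_R`
containing every `c_k/c_j`, `k ≠ j`): a localisation `L = B_𝔔` is a regular local ring of embedding dimension `d`, with
regular system of parameters `(c_j/1, (c_k/c_j)/1)_{k ≠ j}` (the exceptional parameter in slot `j`), and `R → κ(L)` is onto
(the point is RATIONAL over `R/𝔪`). Transport of the tree's `isRegularLocalRing_and_span_originFamily` /
`residue_comp_surjective_origin` (Rees model, `NearPointTauOrigin.lean`) along the bridge. [cite: CossartPiltant2008, proof of Lemma 4.3 (3)] -/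
theorem origin_rsop [IsRegularLocalRing R] (hd : (maximalIdeal R).spanFinrank = d)
    (hc : Ideal.span (Set.range c) = maximalIdeal R)
    (𝔔 : Ideal (blowupAlgebra (Ideal.span (Set.range c)) (c j))) [𝔔.IsPrime]
    (h𝔔 : 𝔔.comap (algebraMap R (blowupAlgebra (Ideal.span (Set.range c)) (c j))) = maximalIdeal R)
    (he : ∀ k, k ≠ j → blowupAlgebra.frac c j k ∈ 𝔔)
    (L : Type u) [CommRing L] [IsLocalRing L] [Algebra (blowupAlgebra (Ideal.span (Set.range c)) (c j)) L]
    [IsLocalization.AtPrime L 𝔔] :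
    IsRegularLocalRing L ∧ (maximalIdeal L).spanFinrank = d ∧
      Ideal.span (Set.range fun k : Fin d =>
        if k = j then algebraMap (blowupAlgebra (Ideal.span (Set.range c)) (c j)) L (algebraMap R _ (c j))
        else algebraMap (blowupAlgebra (Ideal.span (Set.range c)) (c j)) L (blowupAlgebra.frac c j k)) =
        maximalIdeal L ∧
      Function.Surjective ((IsLocalRing.residue L).comp
        ((algebraMap (blowupAlgebra (Ideal.span (Set.range c)) (c j)) L).comp (algebraMap R _))) := by
  classical
  letI alg : Algebra (chartRing c j) L :=
    ((algebraMap (blowupAlgebra (Ideal.span (Set.range c)) (c j)) L).comp (blowupAlgebra.toBlowupAlgebra c j)).toAlgebra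
  haveI := isLocalization_chartRing_of_blowupAlgebra c j 𝔔 L
  haveI : (𝔔.comap (blowupAlgebra.toBlowupAlgebra c j)).IsPrime := Ideal.comap_isPrime _ _
  have hcomp : (blowupAlgebra.toBlowupAlgebra c j).comp (chartBase c j) =
      algebraMap R (blowupAlgebra (Ideal.span (Set.range c)) (c j)) :=
    RingHom.ext fun r => blowupAlgebra.toBlowupAlgebra_reesChartBase c j r
  have h𝔴 : (𝔔.comap (blowupAlgebra.toBlowupAlgebra c j)).comap (chartBase c j) = maximalIdeal R := by
    rw [Ideal.comap_comap, hcomp, h𝔔]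
  have he' : ∀ i, i ≠ j → chartGen c j i ∈ 𝔔.comap (blowupAlgebra.toBlowupAlgebra c j) := fun i hi => by
    rw [Ideal.mem_comap, blowupAlgebra.toBlowupAlgebra_chartGen]
    exact he i hi
  obtain ⟨hreg, hdim, hspan⟩ :=
    isRegularLocalRing_and_span_originFamily hd c hc j (𝔔.comap (blowupAlgebra.toBlowupAlgebra c j)) h𝔴 he' L
  have halg : ∀ y, algebraMap (chartRing c j) L y =
      algebraMap (blowupAlgebra (Ideal.span (Set.range c)) (c j)) L (blowupAlgebra.toBlowupAlgebra c j y) :=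
    fun y => by rw [RingHom.algebraMap_toAlgebra, RingHom.comp_apply]
  have hfam : (fun k : Fin d =>
      if k = j then algebraMap (blowupAlgebra (Ideal.span (Set.range c)) (c j)) L (algebraMap R _ (c j))
      else algebraMap (blowupAlgebra (Ideal.span (Set.range c)) (c j)) L (blowupAlgebra.frac c j k)) =
      originFamily c j L := by
    funext k
    by_cases hk : k = j
    · subst hk
      rw [if_pos rfl, originFamily_self, halg, blowupAlgebra.toBlowupAlgebra_reesChartBase]
    · rw [if_neg hk, originFamily_of_ne c j L hk, halg, blowupAlgebra.toBlowupAlgebra_chartGen]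
  refine ⟨hreg, hdim, by rw [hfam, hspan], ?_⟩
  have hsurj := residue_comp_surjective_origin c j (𝔔.comap (blowupAlgebra.toBlowupAlgebra c j)) h𝔴 he' L
  have hcomp' : ((algebraMap (chartRing c j) L : chartRing c j →+* L).comp (chartBase c j)) =
      (algebraMap (blowupAlgebra (Ideal.span (Set.range c)) (c j)) L).comp (algebraMap R _) := by
    rw [← hcomp, ← RingHom.comp_assoc]
    rfl
  rwa [hcomp'] at hsurj

end Bridge

/-! ## §5. H5 — the FREE-RATIONAL step: at a rational point of the `t`-chart, the point is the ORIGIN of the chart of a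
shifted regular system of parameters, and the new local ring carries the r.s.p. `(t, (c_k − ã_k t)/t)` -/

section FreeRational

variable {X X' : Scheme.{u}} {π : X' ⟶ X} {D : X.IdealSheafData}

set_option maxHeartbeats 1600000 in
-- long existential packaging over the affine blowup algebra of a stalk (as in `BlowupStalkBlowupAlgebra.lean`)
/-- **H5 — THE FREE-RATIONAL STEP (origin presentation at a prescribed chart).** In the situation of
`exists_stalk_presentation` (blow-up `π` along `D` with `D_x = 𝔪_x`, `x′` over `x`, hypersurface presentation
`σ : R ↠ 𝒪_{X,x}`, `ker σ = (h)`, `h ∈ 𝔪^m ∖ 𝔪^{m+1}`, r.s.p. `c` of `R`), fix an index `j₀` (`t := c_{j₀}`) and assume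
(FREE) `x′` lies in the `t`-chart: `π♯σ(t) ∣ π♯σ(c_k)` for all `k` (equivalently `𝓘(E)_{x′} = (π♯σ(t))`; along a tower this is
`¬ IsSatelliteStep`, see `not_isSatelliteStep_iff_forall_dvd`), and (RAT) `κ(x) → κ(x′)` is onto (`IsRationalStep`). Then
there are lifts `ã_k ∈ R` (`k ≠ j₀`) of the coordinates of `x′` such that, for the SHIFTED regular system of parameters
`c̃ = shiftRsop c j₀ ã` (`c̃_{j₀} = t`, `c̃_k = c_k − ã_k t`; tree `NearPointTauMonotone`), the presentation of
`exists_stalk_presentation` holds AT THE INDEX `j₀` with `x′` the ORIGIN of the chart: every `c̃_k/t ∈ 𝔔` (`k ≠ j₀`); and then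
`R′ = R[𝔪/t]_𝔔` is regular local of embedding dimension `d` again, with regular system of parameters
`(t/1, (c̃_k/t)/1)_{k ≠ j₀}` — i.e. `(t, y′)` with `y′_k = c_k/t − ã_k` — and `R → κ(R′)` onto. So the output
`(R′, d, (t, y′), σ′, h′)` has the input shape of `exists_stalk_presentation` and the free-rational tail ITERATES with the same
`t` (ROUTE H, H6(c)). Proof: [CoP1] Lemma 4.3 (3)'s change of parameters, the unit argument forcing the chart index, and the
origin lemma `origin_rsop`. [cite: CossartPiltant2008, proof of Lemma 4.3 (3); GortzWedhorn2020, Prop. 13.96 (2)] -/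
theorem exists_origin_presentation (hπ : IsBlowup π D) (x' : X')
    (hD : stalkIdeal D (π x') = maximalIdeal (X.presheaf.stalk (π x')))
    {R : Type u} [CommRing R] [IsRegularLocalRing R] {d : ℕ} (hd : (maximalIdeal R).spanFinrank = d)
    (c : Fin d → R) (hc : Ideal.span (Set.range c) = maximalIdeal R)
    (σ : R →+* X.presheaf.stalk (π x')) (hσ : Function.Surjective σ) {h : R}
    (hker : RingHom.ker σ = Ideal.span {h}) {m : ℕ} (hm : h ∈ maximalIdeal R ^ m)
    (hm' : h ∉ maximalIdeal R ^ (m + 1)) (j₀ : Fin d)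
    (hfree : ∀ k, (π.stalkMap x').hom (σ (c j₀)) ∣ (π.stalkMap x').hom (σ (c k)))
    (hrat : Function.Surjective (IsLocalRing.ResidueField.map (π.stalkMap x').hom)) :
    ∃ (a : {k : Fin d // k ≠ j₀} → R)
      (𝔔 : PrimeSpectrum (blowupAlgebra (Ideal.span (Set.range (shiftRsop c j₀ a))) (shiftRsop c j₀ a j₀)))
      (h' : blowupAlgebra (Ideal.span (Set.range (shiftRsop c j₀ a))) (shiftRsop c j₀ a j₀))
      (σ' : Localization.AtPrime 𝔔.asIdeal →+* X'.presheaf.stalk x'),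
      algebraMap R _ h = algebraMap R _ (shiftRsop c j₀ a j₀) ^ m * h' ∧
      Prime (algebraMap R (blowupAlgebra (Ideal.span (Set.range (shiftRsop c j₀ a))) (shiftRsop c j₀ a j₀))
        (shiftRsop c j₀ a j₀)) ∧
      ¬ algebraMap R (blowupAlgebra (Ideal.span (Set.range (shiftRsop c j₀ a))) (shiftRsop c j₀ a j₀))
        (shiftRsop c j₀ a j₀) ∣ h' ∧
      𝔔.asIdeal.comap (algebraMap R _) = maximalIdeal R ∧
      h' ∈ 𝔔.asIdeal ∧
      IsRegularLocalRing (Localization.AtPrime 𝔔.asIdeal) ∧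
      Function.Surjective σ' ∧
      RingHom.ker σ' = Ideal.span {algebraMap _ (Localization.AtPrime 𝔔.asIdeal) h'} ∧
      (∀ r : R, σ' (algebraMap _ (Localization.AtPrime 𝔔.asIdeal)
        (algebraMap R (blowupAlgebra (Ideal.span (Set.range (shiftRsop c j₀ a))) (shiftRsop c j₀ a j₀)) r)) =
          (π.stalkMap x').hom (σ r)) ∧
      (∀ k : Fin d, σ' (algebraMap _ (Localization.AtPrime 𝔔.asIdeal) (blowupAlgebra.frac (shiftRsop c j₀ a) j₀ k)) *
        (π.stalkMap x').hom (σ (shiftRsop c j₀ a j₀)) = (π.stalkMap x').hom (σ (shiftRsop c j₀ a k))) ∧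
      (π.stalkMap x').hom (σ (shiftRsop c j₀ a j₀)) ∈ nonZeroDivisors (X'.presheaf.stalk x') ∧
      stalkIdeal (D.comap π) x' = Ideal.span {(π.stalkMap x').hom (σ (shiftRsop c j₀ a j₀))} ∧
      (∀ k, k ≠ j₀ → blowupAlgebra.frac (shiftRsop c j₀ a) j₀ k ∈ 𝔔.asIdeal) ∧
      (maximalIdeal (Localization.AtPrime 𝔔.asIdeal)).spanFinrank = d ∧
      Ideal.span (Set.range fun k : Fin d =>
        if k = j₀ then algebraMap _ (Localization.AtPrime 𝔔.asIdeal)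
          (algebraMap R (blowupAlgebra (Ideal.span (Set.range (shiftRsop c j₀ a))) (shiftRsop c j₀ a j₀))
            (shiftRsop c j₀ a j₀))
        else algebraMap _ (Localization.AtPrime 𝔔.asIdeal) (blowupAlgebra.frac (shiftRsop c j₀ a) j₀ k)) =
        maximalIdeal (Localization.AtPrime 𝔔.asIdeal) ∧
      Function.Surjective ((IsLocalRing.residue (Localization.AtPrime 𝔔.asIdeal)).comp
        ((algebraMap _ (Localization.AtPrime 𝔔.asIdeal)).comp
          (algebraMap R (blowupAlgebra (Ideal.span (Set.range (shiftRsop c j₀ a))) (shiftRsop c j₀ a j₀))))) := by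
  classical
  -- (0) coordinates of the rational point in the `t`-chart: `π♯σ(c_k) = π♯σ(t) · w_k`, `w_k ≡ π♯σ(r_k) mod 𝔪_{x′}`
  have hcoord : ∀ k, ∃ r : R, ∃ w : X'.presheaf.stalk x',
      (π.stalkMap x').hom (σ (c k)) = (π.stalkMap x').hom (σ (c j₀)) * w ∧
      w - (π.stalkMap x').hom (σ r) ∈ maximalIdeal _ := by
    intro k
    obtain ⟨w, hw⟩ := hfree k
    obtain ⟨ρ, hρ⟩ := hrat (IsLocalRing.residue _ w)
    obtain ⟨y, rfl⟩ := Ideal.Quotient.mk_surjective ρ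
    obtain ⟨r, rfl⟩ := hσ y
    refine ⟨r, w, hw, ?_⟩
    rw [← Ideal.Quotient.eq]
    change IsLocalRing.residue _ w = IsLocalRing.residue _ ((π.stalkMap x').hom (σ r))
    rw [← hρ]
    rfl
  choose r w hw hwr using hcoord
  refine ⟨fun k => r k.1, ?_⟩
  -- (1) the shifted system and the presentation of H4 with respect to it
  have hc₂ : Ideal.span (Set.range (shiftRsop c j₀ fun k => r k.1)) = maximalIdeal R := by
    rw [span_range_shiftRsop, hc]
  obtain ⟨j₂, 𝔔, h', σ', h1, h2, h3, h4, h5, h6, h7, h8, h9, h10, h11, h12⟩ :=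
    exists_stalk_presentation hπ x' hD hd (shiftRsop c j₀ fun k => r k.1) hc₂ σ hσ hker hm hm'
  have hc₂j : (π.stalkMap x').hom (σ (shiftRsop c j₀ (fun k => r k.1) j₀)) = (π.stalkMap x').hom (σ (c j₀)) := by
    rw [shiftRsop_self]
  have hc₂k : ∀ k (hk : k ≠ j₀), (π.stalkMap x').hom (σ (shiftRsop c j₀ (fun k => r k.1) k)) =
      (π.stalkMap x').hom (σ (c j₀)) * (w k - (π.stalkMap x').hom (σ (r k))) := by
    intro k hk
    rw [shiftRsop_of_ne c j₀ _ hk, map_sub, map_mul, map_sub, map_mul, hw k]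
    ring
  -- (2) `g = π♯σ(t)` is a non-zero-divisor: it divides the non-zero-divisor `π♯σ(c̃_{j₂})`
  have hgnzd : (π.stalkMap x').hom (σ (c j₀)) ∈ nonZeroDivisors (X'.presheaf.stalk x') := by
    by_cases hj : j₂ = j₀
    · subst hj; rw [← hc₂j]; exact h11
    · have h11' := h11
      rw [hc₂k j₂ hj] at h11'
      exact (mul_mem_nonZeroDivisors.mp h11').1
  -- (3) the chart index is forced: `j₂ = j₀`
  have hj : j₂ = j₀ := by
    by_contra hj
    have e10 := h10 j₀
    rw [hc₂j, hc₂k j₂ hj] at e10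
    have hμ : σ' (algebraMap _ _ (blowupAlgebra.frac (shiftRsop c j₀ fun k => r k.1) j₂ j₀)) *
        (w j₂ - (π.stalkMap x').hom (σ (r j₂))) ∈ maximalIdeal (X'.presheaf.stalk x') :=
      Ideal.mul_mem_left _ _ (hwr j₂)
    have hunit := IsLocalRing.isUnit_one_sub_self_of_mem_nonunits _ hμ
    have hzero : (π.stalkMap x').hom (σ (c j₀)) *
        (1 - σ' (algebraMap _ _ (blowupAlgebra.frac (shiftRsop c j₀ fun k => r k.1) j₂ j₀)) *
          (w j₂ - (π.stalkMap x').hom (σ (r j₂)))) = 0 := by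
      rw [mul_sub, mul_one, sub_eq_zero]
      calc (π.stalkMap x').hom (σ (c j₀))
          = σ' (algebraMap _ _ (blowupAlgebra.frac (shiftRsop c j₀ fun k => r k.1) j₂ j₀)) *
              ((π.stalkMap x').hom (σ (c j₀)) * (w j₂ - (π.stalkMap x').hom (σ (r j₂)))) := e10.symm
        _ = _ := by ring
    have hg0 := (hunit.mul_left_eq_zero).mp hzero
    rw [hg0] at hgnzd
    exact zero_notMem_nonZeroDivisors hgnzd
  subst hj
  -- (4) the point is the ORIGIN: `c̃_k/t ∈ 𝔔` for `k ≠ j₂ (= j₀)`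
  have horig : ∀ k, k ≠ j₂ → blowupAlgebra.frac (shiftRsop c j₂ fun k => r k.1) j₂ k ∈ 𝔔.asIdeal := by
    intro k hk
    have e10 := h10 k
    rw [hc₂j, hc₂k k hk, mul_comm ((π.stalkMap x').hom (σ (c j₂)))] at e10
    have hs : σ' (algebraMap _ _ (blowupAlgebra.frac (shiftRsop c j₂ fun k => r k.1) j₂ k)) =
        w k - (π.stalkMap x').hom (σ (r k)) := (mul_cancel_right_mem_nonZeroDivisors hgnzd).mp e10
    have hsm : σ' (algebraMap _ _ (blowupAlgebra.frac (shiftRsop c j₂ fun k => r k.1) j₂ k)) ∈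
        maximalIdeal (X'.presheaf.stalk x') := hs ▸ hwr k
    have hL : algebraMap _ (Localization.AtPrime 𝔔.asIdeal)
        (blowupAlgebra.frac (shiftRsop c j₂ fun k => r k.1) j₂ k) ∈ maximalIdeal _ := by
      rw [IsLocalRing.mem_maximalIdeal, mem_nonunits_iff] at hsm ⊢
      exact fun hu => hsm (hu.map σ')
    exact (IsLocalization.AtPrime.to_map_mem_maximal_iff (Localization.AtPrime 𝔔.asIdeal) 𝔔.asIdeal _).mp hL
  -- (5) the regular system of parameters at the origin
  obtain ⟨-, hdim, hspan, hres⟩ := origin_rsop (shiftRsop c j₂ fun k => r k.1) j₂ hd hc₂ 𝔔.asIdeal h4 horig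
    (Localization.AtPrime 𝔔.asIdeal)
  exact ⟨𝔔, h', σ', h1, h2, h3, h4, h5, h6, h7, h8, h9, h10, h11, h12, horig, hdim, hspan, hres⟩

/-- **(FREE) holds at SOME index** (the FIRST step of a free-rational tail, where no `t` is prescribed yet): the chart
`j₀` delivered by `exists_stalk_presentation` has `π♯σ(c_{j₀}) ∣ π♯σ(c_k)` for all `k`. [cite: GortzWedhorn2020, Prop. 13.91] -/
theorem exists_index_forall_dvd (hπ : IsBlowup π D) (x' : X')
    (hD : stalkIdeal D (π x') = maximalIdeal (X.presheaf.stalk (π x')))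
    {R : Type u} [CommRing R] [IsRegularLocalRing R] {d : ℕ} (hd : (maximalIdeal R).spanFinrank = d)
    (c : Fin d → R) (hc : Ideal.span (Set.range c) = maximalIdeal R)
    (σ : R →+* X.presheaf.stalk (π x')) (hσ : Function.Surjective σ) {h : R}
    (hker : RingHom.ker σ = Ideal.span {h}) {m : ℕ} (hm : h ∈ maximalIdeal R ^ m)
    (hm' : h ∉ maximalIdeal R ^ (m + 1)) :
    ∃ j₀ : Fin d, ∀ k, (π.stalkMap x').hom (σ (c j₀)) ∣ (π.stalkMap x').hom (σ (c k)) := by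
  obtain ⟨j, 𝔔, h', σ', -, -, -, -, -, -, -, -, -, h10, -, -⟩ :=
    exists_stalk_presentation hπ x' hD hd c hc σ hσ hker hm hm'
  exact ⟨j, fun k => ⟨_, by rw [mul_comm]; exact (h10 k).symm⟩⟩

end FreeRational

end Summit.ResolutionOfSingularities.ResolutionOfSingularities.Cruxes.SigmaMaxModifications.IdeasL1C5.EmbeddedStep

end
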